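import Summits.Ventures.Crystal3D.Theorems.StickyWulffConstantGenericWallFloorRunCountUpper
import Summits.Ventures.Crystal3D.Theorems.StickyWulffConstantGenericWallFloorDiscRowCount
import HarnessLib

/-!
# Bond lines through ONE FACE of a slab sample, counted from above UNIFORMLY in the normal

HONEST FRAMING. Part of the venture `Summits/Ventures/Crystal3D` (cell `crystal3d-full`), helper for the cruxes
`CoaxialWallLaw` (stmt-Ventures-19481) and `GenericWallFloor` (stmt-Ventures-19480) of
`route-Ventures-StickyWulffConstant`: second file of the uniform upper sample-deficit lemma (cf-p1 DECISION (lvii)).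
The tree's `lineCount_upper_offset_window` counts ALL lines meeting the slab sample by their mid-plane crossings, in a
disc enlarged by `R/(2|α|)` and with the cell diameter `≤ 4/|α|` of the projected lattice — both degrade as the class
`W` grazes the wall (`α = ⟪W, ν⟫ → 0`).  Here only the lines EXITING THROUGH A FACE are counted: such a line has a point
within `|α|` (in height) of the face plane, so its crossing with that plane lies in the disc of radius `ρ + 1`, and the
crossings are counted by ROWS (`affine_disc_count_rows`), whose error is linear in the radius whatever the cell.

* **`lineCount_plane_unif`** — `ν` unit, `Ea, Eb` of norm `≤ 1`, `W` unit, `det(Ea, Eb, W)² = 1/2`, `α = ⟪W, ν⟫ ≠ 0`,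
  `s` any offset, `m` any plane height, `ρ ≥ 0`: if every `(a, b) ∈ T ⊆ ℤ²` has an integer `t` with
  `|m − ⟪p, ν⟫| ≤ |α|` and `‖p‖² − ⟪p, ν⟫² ≤ ρ²` (`p = a•Ea + b•Eb + t•W + s`), then
  `#T ≤ √2 |α| π (ρ + 1)² + 12√2 (ρ + 1) + 1` — NO `1/|α|`.
* **`card_faceExits_le_unif`** — for the offset/window sample `P′` and a transversal slot `W` with a unimodular chart:
  the exits `p ∈ P′`, `p + W ∉ P′` whose successor is still laterally inside (`‖p + W + s‖² − ⟪p + W + s, ν⟫² ≤ ρ²`,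
  hence leaves through the top or the bottom face) number at most `√2 |α| π (ρ + 1)² + 12√2 (ρ + 1) + 1`.
  (The lateral exits are counted in the assembly file by the shell count, also uniformly.)

WHAT THIS IS NOT: the sum over the twelve slots is the next file; F-C1 not moved.
-/

noncomputable section

namespace Summit.Ventures.Crystal3D.Theorems

open Summit.Ventures.Crystal3D Finset Matrix
open Literature.MathematicalPhysics.StatisticalMechanics (barlowPos fccStacking constHagg haggLabel_const
  barlowPos_mem)
open scoped InnerProductSpace

/-- The oblique projection of a vector of norm `≤ 1` along a unit `W`: `|α| ‖E − (⟪E,ν⟫/α) W‖ ≤ 2`. -/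
theorem abs_mul_norm_obliqueProj_le {Ea W ν : EuclideanSpace ℝ (Fin 3)} (hEa : ‖Ea‖ ≤ 1) (hW : ‖W‖ = 1)
    (hν : ‖ν‖ = 1) (hα : ⟪W, ν⟫_ℝ ≠ 0) :
    |⟪W, ν⟫_ℝ| * ‖Ea - (⟪Ea, ν⟫_ℝ / ⟪W, ν⟫_ℝ) • W‖ ≤ 2 := by
  set α : ℝ := ⟪W, ν⟫_ℝ with hαdef
  have h1 : |α| * ‖Ea - (⟪Ea, ν⟫_ℝ / α) • W‖ = ‖α • Ea - ⟪Ea, ν⟫_ℝ • W‖ := by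
    rw [← Real.norm_eq_abs, ← norm_smul, smul_sub, smul_smul, mul_div_cancel₀ _ hα]
  rw [h1]
  have h2 : ‖α • Ea - ⟪Ea, ν⟫_ℝ • W‖ ≤ |α| * ‖Ea‖ + |⟪Ea, ν⟫_ℝ| * ‖W‖ := by
    calc ‖α • Ea - ⟪Ea, ν⟫_ℝ • W‖ ≤ ‖α • Ea‖ + ‖⟪Ea, ν⟫_ℝ • W‖ := norm_sub_le _ _
      _ = |α| * ‖Ea‖ + |⟪Ea, ν⟫_ℝ| * ‖W‖ := by
          rw [norm_smul, norm_smul, Real.norm_eq_abs, Real.norm_eq_abs]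
  rw [hW, mul_one] at h2
  have hαle : |α| ≤ 1 := by
    have h := abs_real_inner_le_norm W ν; rw [hW, hν, one_mul] at h; exact h
  have hEaν : |⟪Ea, ν⟫_ℝ| ≤ 1 := by
    have h := abs_real_inner_le_norm Ea ν; rw [hν, mul_one] at h; exact h.trans hEa
  nlinarith [abs_nonneg α, norm_nonneg Ea, abs_nonneg ⟪Ea, ν⟫_ℝ]

/-- The bookkeeping of `lineCount_plane_unif`: from the row count to the uniform bound. -/
theorem lineCount_bound_of_rows {a D x N ρ : ℝ} (ha : 0 < a) (hx : 0 < x) (hρ : 0 ≤ ρ + 1)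
    (hdet : Real.sqrt 2 * a * D = 1) (hax : a * x ≤ 2) (hinv : 1 / x ≤ 2 * Real.sqrt 2)
    (hrows : D * N ≤ Real.pi * (ρ + 1) ^ 2 + (4 * D / x + 2 * x) * (ρ + 1) + D) :
    N ≤ Real.sqrt 2 * a * Real.pi * (ρ + 1) ^ 2 + 12 * Real.sqrt 2 * (ρ + 1) + 1 := by
  have h2pos : 0 < Real.sqrt 2 := Real.sqrt_pos.2 (by norm_num)
  have hN : N = Real.sqrt 2 * a * (D * N) := by
    calc N = (Real.sqrt 2 * a * D) * N := by rw [hdet, one_mul]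
      _ = Real.sqrt 2 * a * (D * N) := by ring
  rw [hN]
  have hstep : Real.sqrt 2 * a * (D * N) ≤
      Real.sqrt 2 * a * (Real.pi * (ρ + 1) ^ 2 + (4 * D / x + 2 * x) * (ρ + 1) + D) :=
    mul_le_mul_of_nonneg_left hrows (by positivity)
  refine hstep.trans ?_
  have hlin : Real.sqrt 2 * a * (4 * D / x + 2 * x) ≤ 12 * Real.sqrt 2 := by
    have e : Real.sqrt 2 * a * (4 * D / x + 2 * x) =
        4 * (Real.sqrt 2 * a * D) * (1 / x) + 2 * Real.sqrt 2 * (a * x) := by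
      field_simp
    rw [e, hdet]
    nlinarith [hinv, hax, h2pos]
  have hexp : Real.sqrt 2 * a * (Real.pi * (ρ + 1) ^ 2 + (4 * D / x + 2 * x) * (ρ + 1) + D) =
      Real.sqrt 2 * a * Real.pi * (ρ + 1) ^ 2 +
        (Real.sqrt 2 * a * (4 * D / x + 2 * x)) * (ρ + 1) + Real.sqrt 2 * a * D := by
    ring
  rw [hexp, hdet]
  nlinarith [hlin, hρ]

/-- **Uniform per-class line count at a plane.** See the module docstring. -/
theorem lineCount_plane_unif (ν : EuclideanSpace ℝ (Fin 3)) (hν : ‖ν‖ = 1)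
    (ρ m : ℝ) (hρ : 0 ≤ ρ) (Ea Eb W s : EuclideanSpace ℝ (Fin 3))
    (hEa : ‖Ea‖ ≤ 1) (hEb : ‖Eb‖ ≤ 1) (hW : ‖W‖ = 1)
    (hdet : (Matrix.det ![WithLp.ofLp Ea, WithLp.ofLp Eb, WithLp.ofLp W]) ^ 2 = 1 / 2)
    (hα : ⟪W, ν⟫_ℝ ≠ 0) (T : Finset (ℤ × ℤ))
    (hT : ∀ p ∈ T, ∃ t : ℤ,
      |m - ⟪(p.1 : ℝ) • Ea + (p.2 : ℝ) • Eb + (t : ℝ) • W + s, ν⟫_ℝ| ≤ |⟪W, ν⟫_ℝ| ∧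
      ‖(p.1 : ℝ) • Ea + (p.2 : ℝ) • Eb + (t : ℝ) • W + s‖ ^ 2 -
          ⟪(p.1 : ℝ) • Ea + (p.2 : ℝ) • Eb + (t : ℝ) • W + s, ν⟫_ℝ ^ 2 ≤ ρ ^ 2) :
    (T.card : ℝ) ≤ Real.sqrt 2 * |⟪W, ν⟫_ℝ| * Real.pi * (ρ + 1) ^ 2 + 12 * Real.sqrt 2 * (ρ + 1) + 1 := by
  have h2pos : 0 < Real.sqrt 2 := Real.sqrt_pos.2 (by norm_num)
  have h2sq : Real.sqrt 2 ^ 2 = 2 := Real.sq_sqrt (by norm_num)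
  set α : ℝ := ⟪W, ν⟫_ℝ with hαdef
  have hαpos : 0 < |α| := abs_pos.2 hα
  have hνν : ⟪ν, ν⟫_ℝ = 1 := by rw [real_inner_self_eq_norm_sq, hν, one_pow]
  -- the oblique projections and the lateral centre
  set X : EuclideanSpace ℝ (Fin 3) := Ea - (⟪Ea, ν⟫_ℝ / α) • W with hX
  set Y : EuclideanSpace ℝ (Fin 3) := Eb - (⟪Eb, ν⟫_ℝ / α) • W with hY
  set c₀ : EuclideanSpace ℝ (Fin 3) := s + ((m - ⟪s, ν⟫_ℝ) / α) • W - m • ν with hc₀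
  have hXν : ⟪X, ν⟫_ℝ = 0 := by
    rw [hX, inner_sub_left, inner_smul_left]; simp only [conj_trivial]; rw [← hαdef]; field_simp; ring
  have hYν : ⟪Y, ν⟫_ℝ = 0 := by
    rw [hY, inner_sub_left, inner_smul_left]; simp only [conj_trivial]; rw [← hαdef]; field_simp; ring
  have hc₀ν : ⟪c₀, ν⟫_ℝ = 0 := by
    rw [hc₀, inner_sub_left, inner_add_left, inner_smul_left, inner_smul_left]; simp only [conj_trivial]
    rw [hνν, ← hαdef]; field_simp; ring
  have hXn : |α| * ‖X‖ ≤ 2 := abs_mul_norm_obliqueProj_le hEa hW hν hα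
  have hYn : |α| * ‖Y‖ ≤ 2 := abs_mul_norm_obliqueProj_le hEb hW hν hα
  -- plane coordinates and the Gram identity
  obtain ⟨A, β, hAβ, hdetA, hAf⟩ := exists_planeCoordinates ν X Y c₀ hν hXν hYν hc₀ν
  have hgram := sq_mul_gram_shear_euclidean Ea Eb W ν hα
  rw [← hαdef, ← hX, ← hY, hdet, hν, one_pow, mul_one, ← hdetA] at hgram
  have hdetabs : Real.sqrt 2 * |α| * |A.det| = 1 := by
    have hnn : 0 ≤ Real.sqrt 2 * |α| * |A.det| := by positivity
    have hsq : (Real.sqrt 2 * |α| * |A.det|) ^ 2 = 1 := by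
      rw [mul_pow, mul_pow, h2sq, sq_abs, sq_abs]; linarith
    exact (pow_eq_one_iff_of_nonneg hnn (by norm_num)).1 hsq
  have hAdet : A.det ≠ 0 := by
    intro h; rw [h, abs_zero, mul_zero] at hdetabs; exact zero_ne_one hdetabs
  -- the row step of the plane lattice is `X`
  have hcol : Real.sqrt (A 0 0 ^ 2 + A 1 0 ^ 2) = ‖X‖ := by
    have h := hAf ![1, 0]
    have e0 : A.mulVec ![1, 0] 0 = A 0 0 := by simp [Matrix.mulVec, dotProduct, Fin.sum_univ_two]
    have e1 : A.mulVec ![1, 0] 1 = A 1 0 := by simp [Matrix.mulVec, dotProduct, Fin.sum_univ_two]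
    rw [e0, e1] at h
    simp only [Matrix.cons_val_zero, Matrix.cons_val_one, one_smul, zero_smul,
      add_zero] at h
    rw [h, Real.sqrt_sq (norm_nonneg _)]
  -- `‖X‖ ≥ |det A|/‖Y‖`, hence `1/‖X‖ ≤ 2√2`
  have hXpos : 0 < ‖X‖ := by
    by_contra hle
    push Not at hle
    have hX0 : ‖X‖ = 0 := le_antisymm hle (norm_nonneg _)
    have : A.det ^ 2 ≤ 0 := by
      rw [hdetA, hX0]; nlinarith [sq_nonneg ⟪X, Y⟫_ℝ]
    exact hAdet (by nlinarith [sq_nonneg A.det])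
  have hinvX : 1 / ‖X‖ ≤ 2 * Real.sqrt 2 := by
    -- `|det A| ≤ ‖X‖‖Y‖` and `√2|α||det A| = 1`, `|α|‖Y‖ ≤ 2`
    have hH : |A.det| ≤ ‖X‖ * ‖Y‖ := by
      have h1 : A.det ^ 2 ≤ (‖X‖ * ‖Y‖) ^ 2 := by rw [hdetA]; nlinarith [sq_nonneg ⟪X, Y⟫_ℝ]
      exact abs_le.2 (abs_le_of_sq_le_sq' h1 (by positivity))
    rw [div_le_iff₀ hXpos]
    have : 1 ≤ Real.sqrt 2 * (|α| * ‖Y‖) * ‖X‖ := by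
      calc (1 : ℝ) = Real.sqrt 2 * |α| * |A.det| := hdetabs.symm
        _ ≤ Real.sqrt 2 * |α| * (‖X‖ * ‖Y‖) := by gcongr
        _ = Real.sqrt 2 * (|α| * ‖Y‖) * ‖X‖ := by ring
    have h3 : Real.sqrt 2 * (|α| * ‖Y‖) * ‖X‖ ≤ Real.sqrt 2 * 2 * ‖X‖ :=
      mul_le_mul_of_nonneg_right (mul_le_mul_of_nonneg_left hYn h2pos.le) (norm_nonneg X)
    linarith
  -- every line of `T` crosses the plane `⟪·,ν⟫ = m` within lateral distance `ρ + 1`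
  have hrows := affine_disc_count_rows A hAdet β (ρ + 1) (by linarith) T ?_
  swap
  · intro ij hij
    obtain ⟨t, ht1, ht3⟩ := hT ij hij
    rw [← hAβ]
    set P₀ : EuclideanSpace ℝ (Fin 3) := (ij.1 : ℝ) • Ea + (ij.2 : ℝ) • Eb + s with hP₀
    set p : EuclideanSpace ℝ (Fin 3) := (ij.1 : ℝ) • Ea + (ij.2 : ℝ) • Eb + (t : ℝ) • W + s with hp
    have hpP : p = P₀ + (t : ℝ) • W := by rw [hp, hP₀]; abel
    have hP₀ν : ⟪P₀, ν⟫_ℝ = (ij.1 : ℝ) * ⟪Ea, ν⟫_ℝ + (ij.2 : ℝ) * ⟪Eb, ν⟫_ℝ + ⟪s, ν⟫_ℝ := by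
      rw [hP₀, inner_add_left, inner_add_left, inner_smul_left, inner_smul_left]; simp
    have heq : c₀ + (ij.1 : ℝ) • X + (ij.2 : ℝ) • Y =
        P₀ + ((m - ⟪P₀, ν⟫_ℝ) / α) • W - m • ν := by
      rw [hP₀ν, hc₀, hX, hY, hP₀]
      have e1 : (m - ((ij.1 : ℝ) * ⟪Ea, ν⟫_ℝ + (ij.2 : ℝ) * ⟪Eb, ν⟫_ℝ + ⟪s, ν⟫_ℝ)) / α =
          -((ij.1 : ℝ) * (⟪Ea, ν⟫_ℝ / α)) - (ij.2 : ℝ) * (⟪Eb, ν⟫_ℝ / α) + (m - ⟪s, ν⟫_ℝ) / α := by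
        field_simp; ring
      rw [e1]
      module
    have hpν : ⟪p, ν⟫_ℝ = ⟪P₀, ν⟫_ℝ + (t : ℝ) * α := by
      rw [hpP, inner_add_left, inner_smul_left]; simp [hαdef]
    set lam : ℝ := (m - ⟪p, ν⟫_ℝ) / α with hlam
    have s1 : (m - ⟪P₀, ν⟫_ℝ) / α = (t : ℝ) + lam := by
      rw [hlam, hpν]; field_simp; ring
    have s2 : lam * α = m - ⟪p, ν⟫_ℝ := by
      rw [hlam]; field_simp
    have heq2 : P₀ + ((m - ⟪P₀, ν⟫_ℝ) / α) • W - m • ν =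
        (p - ⟪p, ν⟫_ℝ • ν) + lam • (W - α • ν) := by
      rw [s1, show m • ν = (⟪p, ν⟫_ℝ + lam * α) • ν by rw [s2]; ring_nf, hpP]
      module
    have hlam_le : |lam| ≤ 1 := by
      rw [hlam, abs_div, div_le_one hαpos]; exact ht1
    have hplat : ‖p - ⟪p, ν⟫_ℝ • ν‖ ≤ ρ := by
      have h2 : ‖p - ⟪p, ν⟫_ℝ • ν‖ ^ 2 ≤ ρ ^ 2 := by
        rw [norm_sub_inner_smul_sq ν _ hν]; exact ht3
      exact (pow_le_pow_iff_left₀ (norm_nonneg _) hρ two_ne_zero).1 h2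
    have hWlat : ‖W - α • ν‖ ≤ 1 := by
      have h2 : ‖W - α • ν‖ ^ 2 ≤ 1 ^ 2 := by
        rw [hαdef, norm_sub_inner_smul_sq ν _ hν, hW]
        nlinarith only [sq_nonneg ⟪W, ν⟫_ℝ]
      exact (pow_le_pow_iff_left₀ (norm_nonneg _) zero_le_one two_ne_zero).1 h2
    have hQlat : ‖c₀ + (ij.1 : ℝ) • X + (ij.2 : ℝ) • Y‖ ≤ ρ + 1 := by
      rw [heq, heq2]
      calc ‖(p - ⟪p, ν⟫_ℝ • ν) + lam • (W - α • ν)‖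
          ≤ ‖p - ⟪p, ν⟫_ℝ • ν‖ + ‖lam • (W - α • ν)‖ := norm_add_le _ _
        _ = ‖p - ⟪p, ν⟫_ℝ • ν‖ + |lam| * ‖W - α • ν‖ := by rw [norm_smul, Real.norm_eq_abs]
        _ ≤ ρ + 1 * 1 := add_le_add hplat (mul_le_mul hlam_le hWlat (norm_nonneg _) zero_le_one)
        _ = ρ + 1 := by ring
    exact pow_le_pow_left₀ (norm_nonneg _) hQlat 2
  -- assemble
  rw [hcol] at hrows
  exact lineCount_bound_of_rows hαpos hXpos (by linarith) hdetabs hXn hinvX hrows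

/-- **Face exits of a transversal class, uniformly.**  See the module docstring.  The chart is given by three vectors
`Ea, Eb, W` and integer coordinate functions `fa, fb, ft` of the site parameters `(k, i, j)` with
`barlowPos k i j = fa • Ea + fb • Eb + ft • W`. -/
theorem card_faceExits_le_unif (ν s : EuclideanSpace ℝ (Fin 3)) (hν : ‖ν‖ = 1)
    (lo R ρ : ℝ) (hρ : 0 ≤ ρ)
    (P : Finset (EuclideanSpace ℝ (Fin 3)))
    (hP : ∀ q, q ∈ P ↔ (q ∈ fccStacking 1 (Real.sqrt (2 / 3)) ∧ lo ≤ ⟪q + s, ν⟫_ℝ ∧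
      ⟪q + s, ν⟫_ℝ ≤ lo + R ∧ ‖q + s‖ ^ 2 - ⟪q + s, ν⟫_ℝ ^ 2 ≤ ρ ^ 2))
    (Ea Eb W : EuclideanSpace ℝ (Fin 3)) (hEa : ‖Ea‖ ≤ 1) (hEb : ‖Eb‖ ≤ 1) (hW : ‖W‖ = 1)
    (hdet : (Matrix.det ![WithLp.ofLp Ea, WithLp.ofLp Eb, WithLp.ofLp W]) ^ 2 = 1 / 2)
    (hα : ⟪W, ν⟫_ℝ ≠ 0) (hWslot : W ∈ fccSlots)
    (fa fb ft : ℤ → ℤ → ℤ → ℤ)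
    (hchart : ∀ k i j : ℤ, barlowPos 1 (Real.sqrt (2 / 3)) constHagg k i j =
      (fa k i j : ℝ) • Ea + (fb k i j : ℝ) • Eb + (ft k i j : ℝ) • W) :
    (((P.filter fun p => p + W ∉ P).filter fun p =>
        ‖p + W + s‖ ^ 2 - ⟪p + W + s, ν⟫_ℝ ^ 2 ≤ ρ ^ 2).card : ℝ) ≤
      Real.sqrt 2 * |⟪W, ν⟫_ℝ| * Real.pi * (ρ + 1) ^ 2 + 12 * Real.sqrt 2 * (ρ + 1) + 1 := by
  classical
  set F := P.filter fun p => p + W ∉ P with hF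
  set G := F.filter fun p => ‖p + W + s‖ ^ 2 - ⟪p + W + s, ν⟫_ℝ ^ 2 ≤ ρ ^ 2 with hG
  have hGF : ∀ p ∈ G, p ∈ F := fun p hp => (mem_filter.1 hp).1
  -- integer coordinates of the points of `F`
  have hcoord : ∀ p ∈ F, ∃ k i j : ℤ, p = barlowPos 1 (Real.sqrt (2 / 3)) constHagg k i j := by
    intro p hp
    exact ((hP p).1 (mem_filter.1 hp).1).1
  choose! kf pf qf hc using hcoord
  set idx : EuclideanSpace ℝ (Fin 3) → ℤ × ℤ := fun p =>
    (fa (kf p) (pf p) (qf p), fb (kf p) (pf p) (qf p)) with hidx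
  have hrepr : ∀ p ∈ F, p = ((idx p).1 : ℝ) • Ea + ((idx p).2 : ℝ) • Eb +
      (ft (kf p) (pf p) (qf p) : ℝ) • W := by
    intro p hp
    conv_lhs => rw [hc p hp]
    rw [hchart]
  -- convexity: at most one point of `F` per line (verbatim from `card_filter_add_notMem_le_lineCount`)
  have hconv := convex_offsetSampleRegion ν s hν lo R ρ hρ
  have hinj : Set.InjOn idx ↑F := by
    intro p hp p' hp' hpp'
    have hpF := mem_coe.1 hp
    have hp'F := mem_coe.1 hp'
    have ep := hrepr p hpF
    have ep' := hrepr p' hp'F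
    rw [← hpp'] at ep'
    set t : ℤ := ft (kf p) (pf p) (qf p)
    set t' : ℤ := ft (kf p') (pf p') (qf p')
    have hdiff : p' = p + ((t' : ℝ) - t) • W := by
      calc p' = ((idx p).1 : ℝ) • Ea + ((idx p).2 : ℝ) • Eb + (t' : ℝ) • W := ep'
        _ = (((idx p).1 : ℝ) • Ea + ((idx p).2 : ℝ) • Eb + (t : ℝ) • W) + ((t' : ℝ) - t) • W := by
            module
        _ = p + ((t' : ℝ) - t) • W := by rw [← ep]
    have key : ∀ (x y : EuclideanSpace ℝ (Fin 3)) (n : ℤ), x ∈ F → y ∈ P → y = x + (n : ℝ) • W →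
        1 ≤ n → False := by
      intro x y n hx hy hyx hn
      have hxP : x ∈ P := (mem_filter.1 hx).1
      have hxW : x + W ∉ P := (mem_filter.1 hx).2
      apply hxW
      rw [hP]
      refine ⟨add_mem_fcc_of_mem_fccSlots ((hP x).1 hxP).1 hWslot, ?_⟩
      have hnR : (1 : ℝ) ≤ n := by exact_mod_cast hn
      have hn0 : (0 : ℝ) < n := by linarith
      have hcvx : x + W = (1 - 1 / (n : ℝ)) • x + (1 / (n : ℝ)) • y := by
        rw [hyx, smul_add, smul_smul, one_div, inv_mul_cancel₀ hn0.ne', one_smul]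
        module
      have hxK := ((hP x).1 hxP).2
      have hyK := ((hP y).1 hy).2
      have hmem := hconv (x := x) (y := y) hxK hyK (a := 1 - 1 / (n : ℝ)) (b := 1 / (n : ℝ))
        (by rw [sub_nonneg, div_le_one hn0]; exact hnR) (by positivity) (by ring)
      rw [← hcvx] at hmem
      exact hmem
    rcases lt_trichotomy t t' with hlt | heq | hgt
    · exact (key p p' (t' - t) hpF (mem_filter.1 hp'F).1 (by rw [hdiff]; push_cast; rfl)
        (by omega)).elim
    · rw [hdiff, heq, sub_self, zero_smul, add_zero]
    · refine (key p' p (t - t') hp'F (mem_filter.1 hpF).1 ?_ (by omega)).elim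
      rw [hdiff]; push_cast; module
  have hinjG : Set.InjOn idx ↑G := fun p hp p' hp' h =>
    hinj (mem_coe.2 (hGF p (mem_coe.1 hp))) (mem_coe.2 (hGF p' (mem_coe.1 hp'))) h
  -- the face plane: top for `α > 0`, bottom for `α < 0`
  set α := ⟪W, ν⟫_ℝ with hαdef
  set m : ℝ := if 0 < α then lo + R else lo with hm
  set T := G.image idx with hT
  have hcard : (G.card : ℝ) = (T.card : ℝ) := by rw [hT, card_image_of_injOn hinjG]
  rw [hcard]
  refine lineCount_plane_unif ν hν ρ m hρ Ea Eb W s hEa hEb hW hdet hα T ?_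
  intro ab hab
  obtain ⟨p, hp, rfl⟩ := mem_image.1 hab
  refine ⟨ft (kf p) (pf p) (qf p), ?_⟩
  have hpF := hGF p hp
  rw [← hrepr p hpF]
  obtain ⟨hpP, hpW⟩ := mem_filter.1 hpF
  obtain ⟨hpfcc, h1, h2, h3⟩ := (hP p).1 hpP
  have hlat := (mem_filter.1 hp).2
  refine ⟨?_, h3⟩
  -- the successor is a site, laterally inside, not in `P`: its height is outside the window
  have hout : ¬ (lo ≤ ⟪p + W + s, ν⟫_ℝ ∧ ⟪p + W + s, ν⟫_ℝ ≤ lo + R) := by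
    intro hh
    apply hpW
    rw [hP]
    exact ⟨add_mem_fcc_of_mem_fccSlots hpfcc hWslot, hh.1, hh.2, hlat⟩
  have hsucc : ⟪p + W + s, ν⟫_ℝ = ⟪p + s, ν⟫_ℝ + α := by
    rw [show p + W + s = (p + s) + W by abel, inner_add_left]
  rw [hsucc] at hout
  by_cases hpos : 0 < α
  · have hmv : m = lo + R := by simp [hm, hpos]
    rw [hmv, abs_of_pos hpos]
    have : lo + R < ⟪p + s, ν⟫_ℝ + α := by
      by_contra hle; push Not at hle; exact hout ⟨by linarith, hle⟩
    rw [abs_le]; constructor <;> linarith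
  · have hneg : α < 0 := lt_of_le_of_ne (not_lt.1 hpos) hα
    have hmv : m = lo := by simp [hm, hpos]
    rw [hmv, abs_of_neg hneg]
    have : ⟪p + s, ν⟫_ℝ + α < lo := by
      by_contra hle; push Not at hle; exact hout ⟨hle, by linarith⟩
    rw [abs_le]; constructor <;> linarith

end Summit.Ventures.Crystal3D.Theorems

end
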